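import Summits.QuantumFields.BalabanUV.Beta.EriceFlowEnclosureB12AsPrintedHistoryContagionShiftFlowRepinOpen
import Summits.QuantumFields.BalabanUV.Beta.EriceFlowEnclosureB12AsPrintedHistoryContagionShiftFlowPicardEnd

/-!
# Beta / EriceFlowEnclosureB12AsPrintedHistoryContagionShiftFlowRepinOpenEnd — ASYMPTOTIC FREEDOM IS CONTAGIOUS, part 27 (the open END, one threshold): EVERY LIMIT
# FUNCTIONAL NEAR `betaInf S.β` IS WELL POSED NEAR ZERO AT ONE THRESHOLD, ITS SOLUTION PICARD-COMPUTABLE — FROM THEOREM 2 AS TYPED FOR ONE SETTING.  Part 20 carried TWO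
# thresholds for the perturbed functionals (AF solutions from every pin ≤ g₁₃; exactly one only from pins ≤ g₁₄ < g₁₃, g₁₄ depending on 1∕g₁₃²).  With part 27's same-pin
# well-posedness they merge: from `Theorem2Statement S hL` (a HYPOTHESIS) + `hrg` on ]0, γ_u] + NE4 + `HistLipschitz`∕`FadingMemory` (0 < θ < 1; γ_u ARBITRARY), for every torus
# exponent m there are η₀ > 0 and g₁₇ > 0 such that for EVERY functional B′ with `MemoryProfile C θ γ_u B′` and `|betaInf S.β − B′| ≤ η ≤ η₀` on the box and EVERY pin
# g ∈ ]0, g₁₇]: node U2's `solution B′ g` is box-valued, solves `MemFlow B′ g ·`, is asymptotically free (`1∕(4g²) + ((b − 4η)∕4)m′ ≤ 1∕solution²`), is the scale-wise limit of node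
# U2's lattice-free `iterate B′ g`, and EVERY box solution of B′'s flow from g equals it — node U2's ENTIRE §4 (`existsUnique_memFlow`, `memFlow_solution`,
# `eq_solution_of_memFlow`, `tendsto_iterate`) for every functional in an open sup-norm ball around the limit functional of ONE Setting satisfying Theorem 2 as typed, with
# NO floor and ONE threshold; Theorem 2 is NOT asked of the perturbation.
# (β-flow team, prover 1, unit `b2b-balaban-beta-bflow-p1`, gen 38; ROW AP-I·Uc × NODE U2 — the open END at one threshold)

HONEST FRAMING (page 1 of everything the β sub-cell writes): discharging `BetaPertH` makes Bałaban's UV stability UNCONDITIONAL — a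
real constructive-QFT result; it is NOT the continuum limit and NOT the Clay problem.  HONEST DEPENDENCY (cell reorg 2026-08-19,
verbatim): «continuum YM on T⁴ ⇐ BetaPertH ∧ nine spine estimates (0/9 proved); BetaPertH ⇐ (D1) ∧ (D4) ∧ CAP+tail; G-an2-4 gates
asym, D1 and NE2/3/4.»  THIS MODULE DISCHARGES NOTHING: it is BOOKKEEPING BY NAME — part 15's `reference_of_typedTheorem2`, part 11's `flow_threshold_exists`, part 27's
`memFlow_solution_of_close`, node U2's `memoryProfile_betaInf`.  `Theorem2Statement S hL` ([I] THEOREM 2 p. 259, STATED WITHOUT PROOF there — typed by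
`b2b-balaban-beta-asprinted`, NOT proved here or anywhere in the tree), `hrg` (the runs (0.20) p. 256 of the Setting's coupling function), NE4 `ScaleShiftRate` (GAPS
G-t4-U2-1: [I] has NO statement on the k-dependence of β_k, p. 298), `HistLipschitz` ∕ `FadingMemory` (GAPS G-t4-U2-2) are HYPOTHESES about an abstract `S : Setting`; the
perturbation B′ is an ABSTRACT functional with a displayed memory profile and displayed sup-closeness — none of this is asserted for Bałaban's actual β.  [I] = T. Bałaban,
Commun. Math. Phys. **109** (1987) 249–301 [Balaban1987RG1].

WHAT THIS FILE PROVES (0 sorry, 0 def): §41 **`wellPosed_nearby_oneThreshold_of_typedTheorem2`**.  NOT CLAIMED: Theorem 2; anything about Bałaban's β; `BetaPertH`; the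
continuum limit of the measures; Clay.
-/

namespace Summit.QuantumFields.BalabanUV.Beta.EriceFlowEnclosureB12AsPrintedHistoryContagionShiftFlowRepinOpenEnd

open Finset Filter Topology
open Literature.MathematicalPhysics.QuantumFieldTheory.Balaban1983to89
open Literature.MathematicalPhysics.QuantumFieldTheory.Balaban1983to89.B12BetaAsPrinted
open Literature.MathematicalPhysics.QuantumFieldTheory.Balaban1983to89.FlowStep (RGEqH)
open Literature.MathematicalPhysics.QuantumFieldTheory.Balaban1983to89.T4CouplingMatching (HistLipschitz FadingMemory ScaleShiftRate)
open Literature.MathematicalPhysics.QuantumFieldTheory.Balaban1983to89.T4BetaStationary (SeqBox MemoryProfile betaInf memoryProfile_betaInf)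
open Literature.MathematicalPhysics.QuantumFieldTheory.Balaban1983to89.T4BetaFlowWellPosed (MemFlow iterate solution)
open Summit.QuantumFields.BalabanUV.Beta.EriceFlowEnclosureB12AsPrintedHistoryContagionShiftFlowEnd (flow_threshold_exists)
open Summit.QuantumFields.BalabanUV.Beta.EriceFlowEnclosureB12AsPrintedHistoryContagionShiftFlowPicardEnd (reference_of_typedTheorem2)
open Summit.QuantumFields.BalabanUV.Beta.EriceFlowEnclosureB12AsPrintedHistoryContagionShiftFlowRepinOpen (memFlow_solution_of_close)

noncomputable section

variable {S : Setting}

/-! ## §41 One threshold for every nearby functional: existence, uniqueness and Picard computability at the same pin -/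

/-- **EVERY NEARBY LIMIT FUNCTIONAL IS WELL POSED NEAR ZERO AT ONE THRESHOLD — FROM THEOREM 2 AS TYPED FOR ONE SETTING.**  `Theorem2Statement S hL` (a HYPOTHESIS), the binder
`hrg` on ]0, γ_u], NE4 `ScaleShiftRate c θ γ_u S.β` (c ≥ 0), `HistLipschitz Λ γ_u S.β` with `FadingMemory C θ Λ` (0 < θ < 1, C ≥ 0; γ_u ARBITRARY against (C, θ)) ⟹ for every
torus exponent m there are η₀ > 0, a rate b > 4η₀ and g₁₇ > 0 such that for EVERY functional B′ with `MemoryProfile C θ γ_u B′` and `|betaInf S.β u − B′ u| ≤ η ≤ η₀` for all box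
u, and EVERY pin g ∈ ]0, g₁₇]: (i) node U2's `solution B′ g` is box-valued in ]0, γ_u] and solves `MemFlow B′ g ·`; (ii) it is asymptotically free, `1∕(4g²) + ((b − 4η)∕4)m′ ≤
1∕(solution B′ g m′)²`; (iii) node U2's lattice-free `iterate B′ g n m′ → solution B′ g m′`; (iv) EVERY box solution of `MemFlow B′ g ·` equals `solution B′ g` — so
`∃! h, SeqBox γ_u h ∧ MemFlow B′ g h` at EVERY g ≤ g₁₇: part 20's thresholds g₁₃ (existence) and g₁₄ (uniqueness) MERGED by part 23's uniqueness at the reference pin.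
Theorem 2 is NOT asked of B′. [cite: Balaban1987RG1, Thm 2 (0.31) p.259 with (0.20) p.256 and §5 p.298] -/
theorem wellPosed_nearby_oneThreshold_of_typedTheorem2 {hL : Odd S.L ∧ 1 < S.L} (h : Theorem2Statement S hL)
    {γu θ C c : ℝ} {Λ : ℕ → ℕ → ℝ} (hγu : 0 < γu)
    (hrg : ∀ P : B12.RunParams, Step.InInterval γu P.K (S.cpl P) → RGEqH P.K S.β (S.cpl P))
    (hS : ScaleShiftRate c θ γu S.β) (hL' : HistLipschitz Λ γu S.β) (hΛ : FadingMemory C θ Λ)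
    (hθ0 : 0 < θ) (hθ1 : θ < 1) (hC : 0 ≤ C) (hc : 0 ≤ c) (m : ℕ) :
    ∃ η₀ b g₁₇ : ℝ, 0 < η₀ ∧ 4 * η₀ < b ∧ 0 < g₁₇ ∧ ∀ (B' : (ℕ → ℝ) → ℝ) (η : ℝ), MemoryProfile C θ γu B' →
      (∀ u : ℕ → ℝ, SeqBox γu u → |betaInf S.β u - B' u| ≤ η) → η ≤ η₀ →
      ∀ g : ℝ, 0 < g → g ≤ g₁₇ →
        SeqBox γu (solution B' g) ∧ MemFlow B' g (solution B' g) ∧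
        (∀ m' : ℕ, 1 / (4 * g ^ 2) + (b - 4 * η) / 4 * (m' : ℝ) ≤ 1 / (solution B' g m') ^ 2) ∧
        (∀ m', Tendsto (fun n => iterate B' g n m') atTop (𝓝 (solution B' g m'))) ∧
        (∀ h' : ℕ → ℝ, SeqBox γu h' → MemFlow B' g h' → h' = solution B' g) ∧
        (∃! h' : ℕ → ℝ, SeqBox γu h' ∧ MemFlow B' g h') := by
  have h1θ : 0 < 1 - θ := by linarith
  have hB := memoryProfile_betaInf hS hL' hΛ hθ0.le hθ1
  obtain ⟨gr, b, -, -, t, hgr, hb, -, -, htbox, htflow, hprof, -, -⟩ := reference_of_typedTheorem2 h hγu hrg hS hL' hΛ hθ0 hθ1 hC hc m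
  have h2gr : 0 < 2 * gr := by positivity
  have h16C : 0 ≤ 16 * C := by positivity
  obtain ⟨e₀, he₀, hthr⟩ := flow_threshold_exists (1 / gr ^ 2 + C * γu / (1 - θ) ^ 2 + (2 * C / ((1 - θ) * b)) ^ 2) hC hθ1 hb
  obtain ⟨e₁, he₁, hthr'⟩ := flow_threshold_exists (6 * (C * γu / (1 - θ) ^ 2 + (16 * C / ((1 - θ) * b)) ^ 2)) h16C hθ1 hb
  refine ⟨b / 8, b, min e₀ (min e₁ (γu / 4)), by positivity, by linarith, lt_min he₀ (lt_min he₁ (by positivity)),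
    fun B' η hB' hη hηle g hg hle => ?_⟩
  obtain ⟨hs1, hs2, hs4⟩ := hthr g hg (hle.trans (min_le_left _ _))
  obtain ⟨hs1', hs2', hs4'⟩ := hthr' g hg (hle.trans ((min_le_right _ _).trans (min_le_left _ _)))
  have h4g : 4 * g ≤ γu := by linarith [hle.trans ((min_le_right _ _).trans (min_le_right _ _))]
  have hη4 : 4 * η < b := by linarith
  have hbη : b / 2 ≤ b - 4 * η := by linarith
  have hbη0 : 0 < b - 4 * η := by linarith
  -- the same-pin conditions at the actual rate (b − 4η)∕4 from the conditions at the rate floor b∕8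
  have hp1 : 32 * C * g ≤ (b - 4 * η) * (1 - θ) := by nlinarith [mul_nonneg hC hg.le]
  have hp2 : 4 * g ^ 2 * (C * γu / (1 - θ) ^ 2 + (8 * C / ((1 - θ) * (b - 4 * η))) ^ 2) ≤ 1 / 2 := by
    have h1 : 8 * C / ((1 - θ) * (b - 4 * η)) ≤ 8 * C / ((1 - θ) * (b / 2)) :=
      div_le_div_of_nonneg_left (by positivity) (by positivity) (mul_le_mul_of_nonneg_left hbη h1θ.le)
    have e2 : 8 * C / ((1 - θ) * (b / 2)) = 16 * C / ((1 - θ) * b) := by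
      field_simp
      ring
    rw [e2] at h1
    have h0 : 0 ≤ 8 * C / ((1 - θ) * (b - 4 * η)) := by positivity
    nlinarith [pow_le_pow_left₀ h0 h1 2, sq_nonneg g]
  have hp4 : 512 * C * g ^ 3 ≤ (1 - θ) ^ 2 := by nlinarith [mul_nonneg hC (pow_nonneg hg.le 3)]
  obtain ⟨hss, hsf, hprofs, hlim, huniq⟩ :=
    memFlow_solution_of_close hB hB' hC hθ0.le hθ1 hb h2gr htbox htflow hprof hη hη4 hg h4g hs1 hs2 hs4 hp1 hp2 hp4
  exact ⟨hss, hsf, hprofs, hlim, huniq, ⟨solution B' g, ⟨hss, hsf⟩, fun h' hh' => huniq h' hh'.1 hh'.2⟩⟩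

end

end Summit.QuantumFields.BalabanUV.Beta.EriceFlowEnclosureB12AsPrintedHistoryContagionShiftFlowRepinOpenEnd
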